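import Literature.Computability.MetaComplexity.OneSidedHeuristics
import Literature.Computability.MetaComplexity.SearchHeuristicSchemes
import Literature.Computability.MetaComplexity.DistProblemsProofs
import Literature.Computability.MetaComplexity.SchemeEncBricks
import Literature.Computability.Complexity.FinitePatching
import Mathlib.Data.Set.Finite.List
import HarnessLib

/-!
# One-sided-error heuristics (proofs): `DistNP ⊆ AvgP ⟹ coNP × {U, T} ⊆ Avg¹_{1-n^{-c}} P`, and Lemma 2.2 (1) from Cor. 8.12 / Thm. 8.9

Sibling proof file of `OneSidedHeuristics.lean` (Hirahara, STOC 2021 = ECCC TR21-058, whose numbering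
is cited). It proves the "easy" first step of the paper's route from `DistNP ⊆ AvgP` to universal
heuristic schemes for `UP` (p. 9: "Using the characterization of `AvgP` by an errorless heuristic
notion … it is easy to see that `Avg_P P ⊆ AvgP ⊆ Avg¹_{1-n^{-c}} P`"; §11, p. 51), in the tree's
Bogdanov–Trevisan conventions (`DistProblems.lean`):

* `tallyEnsemble_mem_PSamp` — `T ∈ PSamp` (the sampler ignores its coins and prints `1ⁿ`);
* `polyTimeComputable_map_not_optBoolEnc`, `AvgP_compl` — `AvgP` is closed under complementing the
  language (negate the answer, keep `⊥`);
* `mem_Avg1DeltaP_of_mem_AvgP` — an errorless heuristic scheme for `(L, D)` yields, for every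
  `c ≥ 1`, a one-sided-error heuristic algorithm of failure probability `1 - n^{-c}` **provided
  `supp D₁` is finite**: for `n ≠ 1` run the scheme with `δ = 1/2` and answer `0` instead of `⊥`
  (no false positives by errorlessness; success probability `≥ 1/2 ≥ n^{-c}` for `n ≥ 2`, void at
  `n = 0`), while at `n = 1` the printed bound demands success probability `n^{-c} = 1`, which is met
  by hard-wiring `L` on the finite set `supp D₁` (`FP` is closed under finite patching,
  `mem_FP_of_eqOn_le`). For `U` and `T` the proviso holds (`supp U₁ = {0,1}`, `supp T₁ = {1}`);
* `distClass_coNP_subset_Avg1DeltaP_of_DistNP_subset_AvgP` — **`DistNP ⊆ AvgP ⟹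
  coNP × {U, T} ⊆ Avg¹_{1-n^{-c}} P` for every `c ≥ 1`** (for `L ∈ coNP` and `D ∈ {U, T} ⊆ PSamp`,
  `(Lᶜ, D) ∈ DistNP ⊆ AvgP`, complement, then the previous item);
* `Hirahara2021_hasUHS_of_mem_UP_of` — **Lemma 2.2 (1) (`Hirahara2021_hasUHS_of_mem_UP`) from the
  `UP` case of Cor. 8.12**, the latter an explicit hypothesis (`coNP × {U, T} ⊆ Avg¹_{1-n^{-c}} P` for
  some `c` ⟹ every `L ∈ UP` has a universal heuristic scheme, for every `U`), i.e. the paper's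
  sentence "Since `UP ⊆ NP_sv`, Item 1 of Theorem 1.6 is a special case of Theorem 11.1" (p. 51) up to
  the deep Cor. 8.12;
* `Hirahara2021_hasUHS_of_mem_UP_of_search` — **Lemma 2.2 (1) from the named fact
  `Hirahara2021_UP_searchUHS_of_Avg1P`** (Thm. 8.9 for `UP`-type verifiers,
  `SearchHeuristicSchemes.lean`, the only named fact of the paper's §8 in the tree), through the proved
  Cor. 8.12 for `UP` (`Hirahara2021_UP_hasUHS_of_Avg1P_of_search`: a decision problem reduces to its
  search version). The discharge of Lemma 2.2 (1) is thereby reduced to Thm. 8.9 (for `UP`), whose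
  proof relative to its §3–§5 ingredients is `Hirahara2021_UP_searchUHS_of_Avg1P_of`
  (`UPSearchAssembly.lean`).

All machines are compositions of existing bricks (`PolyTimeComputable.comp_holds`,
`polyTimeComputable_decScheme`, `fanoutFn`, `polyTimeComputable_getD_optBoolEnc`, finite-state
transducers `FST`, `mem_FP_of_eqOn_le`); no `TM2` program is written here.

## References

* S. Hirahara, *Average-case hardness of NP from exponential worst-case hardness assumptions*, STOC 2021;
  full version ECCC TR21-058: p. 9 (`AvgP ⊆ Avg¹_{1-n^{-c}} P`), Def. 3.3, Lemma 2.2 (1), Fact 8.4,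
  Thm. 8.9, Cor. 8.12, Thm. 11.1 and p. 51.
* A. Bogdanov, L. Trevisan, *Average-Case Complexity*, Found. Trends TCS 2 (2006), §2.1 (Def. 2.1,
  `PSamp`), §2.2 (errorless schemes; closing remark "replacing `⊥` by an arbitrary output").
* S. Arora, B. Barak, *Computational Complexity: A Modern Approach*, CUP 2009, §1.3 (composition;
  hard-wiring finitely many inputs).
-/

namespace Literature.Computability.MetaComplexity

open _root_.Computability Complexity Complexity.Classes Complexity.Nondeterministic
open scoped ENNReal

/-! ### The tally ensemble is samplable -/

/-- **`T ∈ PSamp`.** The sampler `⟨(n, r) ↦ 1ⁿ, coinLen = 0⟩` prints its input `1ⁿ` and ignores its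
coins: its machine is the first pair projection `⟨1ⁿ, r⟩ ↦ 1ⁿ` (`boolUnpairFst_mem_FP`), and its output
law is the push-forward of a (one-point) uniform distribution along a constant map, the point mass
`Tₙ` (`PMF.map_const`). [Bogdanov–Trevisan 2006, §2.1 (Def. 2.1); Hirahara 2021 (ECCC TR21-058), p. 9
and Lemma 3.4 (the tally distribution as a samplable hard distribution)]
[cite: BogdanovTrevisan2006, §2.1 (Def. 2.1)] -/
theorem tallyEnsemble_mem_PSamp : tallyEnsemble ∈ PSamp := by
  have hfst : PolyTimeComputable (id : List Bool → List Bool) id fun z => (boolUnpair z).1 :=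
    boolUnpairFst_mem_FP
  obtain ⟨p, M, hM⟩ := hfst
  refine ⟨⟨fun n _ => unaryEncodeNat n, fun _ => 0⟩, ⟨⟨p, M, fun q => ?_⟩, 0, fun n => by simp⟩,
    fun n => ?_⟩
  · have h := hM (boolPair (unaryEncodeNat q.1) q.2)
    simp only [id, boolUnpair_boolPair] at h
    exact h
  · exact PMF.map_const _ _

/-! ### `AvgP` is closed under complement -/

/-- The *flip* transducer `⟨0, (s, c) ↦ (1, [c] if s = 0 else [¬c]), [], keep⟩` copies the first
symbol (the tag of `optBoolEnc`) and negates the following ones: on `optBoolEnc none = [0]` it writes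
`[0]`, on `optBoolEnc (some b) = [1, b]` it writes `[1, ¬b]`; i.e. it computes `o ↦ o.map not` on
`{0, 1, ⊥}`. (A structure literal, so that this file stays a pure proof file.) [folklore] -/
private theorem flipFST_eval_optBoolEnc (o : Option Bool) :
    (⟨false, fun s c => (true, [if s then !c else c]), fun _ => [], fun _ => true⟩ :
        FST Bool Bool Bool).eval (optBoolEnc o) = optBoolEnc (o.map not) := by
  rcases o with _ | b
  · rfl
  · cases b <;> rfl

/-- Negating a `{0, 1, ⊥}`-valued answer, `o ↦ o.map not` (`⊥ ↦ ⊥`), is polynomial-time on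
`optBoolEnc`: a two-state finite-state transduction (`FST.polyTimeComputable_eval`,
`flipFST_eval_optBoolEnc`). [Arora–Barak 2009, §1.2 (routine machine)] [folklore] -/
theorem polyTimeComputable_map_not_optBoolEnc :
    PolyTimeComputable optBoolEnc optBoolEnc fun o : Option Bool => o.map not := by
  obtain ⟨p, M, hM⟩ :=
    (⟨false, fun s c => (true, [if s then !c else c]), fun _ => [], fun _ => true⟩ :
        FST Bool Bool Bool).polyTimeComputable_eval
  refine ⟨p, M, fun o => ?_⟩
  have h := hM (optBoolEnc o)
  rw [flipFST_eval_optBoolEnc] at h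
  exact h

/-- The indicator of the complement is the negated indicator. [Mathlib `Set.boolIndicator`]
[folklore] -/
private theorem boolIndicator_compl (L : Language Bool) (x : List Bool) :
    Lᶜ.boolIndicator x = !L.boolIndicator x := by
  by_cases hx : x ∈ L
  · rw [(Set.mem_iff_boolIndicator _ _).1 hx,
      (Set.notMem_iff_boolIndicator _ _).1 (fun h : x ∈ Lᶜ => h hx)]
    rfl
  · rw [(Set.notMem_iff_boolIndicator _ _).1 hx,
      (Set.mem_iff_boolIndicator _ _).1 (show x ∈ Lᶜ from hx)]
    rfl

/-- **`AvgP` is closed under complementing the language**: if `(L, D) ∈ AvgP` then `(Lᶜ, D) ∈ AvgP`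
— negate the answers of the errorless heuristic scheme and keep `⊥`
(`polyTimeComputable_map_not_optBoolEnc` after the scheme, `PolyTimeComputable.comp_holds`); the failure
events are unchanged and errorlessness on the support is preserved. This is the step
"`(Lᶜ, D) ∈ DistNP ⊆ AvgP` for `L ∈ coNP`" of Hirahara's passage from `DistNP ⊆ AvgP` to
`coNP × {U, T} ⊆ Avg¹ P` (p. 9, §11). [Bogdanov–Trevisan 2006, §2.2 (Def. 2.4); Hirahara 2021
(ECCC TR21-058), p. 9] [cite: BogdanovTrevisan2006, §2.2 (Def. 2.4)] -/
theorem AvgP_compl {Q : DistProblem} (hQ : Q ∈ AvgP) :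
    (⟨Q.langᶜ, Q.dist⟩ : DistProblem) ∈ AvgP := by
  obtain ⟨A, hA, herr, hfail⟩ := hQ
  refine ⟨fun x n m => (A x n m).map not,
    PolyTimeComputable.comp_holds polyTimeComputable_map_not_optBoolEnc hA, ?_, ?_⟩
  · intro m n x hx b hb
    change (A x n m).map not = some b at hb
    change b = (Q.langᶜ).boolIndicator x
    rcases hAx : A x n m with _ | b'
    · rw [hAx] at hb
      exact absurd hb (by simp)
    · rw [hAx] at hb
      have hb' : b = !b' := by simpa [eq_comm] using hb
      rw [hb', herr m n x hx b' hAx, boolIndicator_compl]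
  · intro n m hm
    have hset : {x | (A x n m).map not = none} = {x | A x n m = none} := by
      ext x
      simp
    change Q.dist.prob n {x | (A x n m).map not = none} ≤ 1 / m
    rw [hset]
    exact hfail n m hm

/-! ### From errorless schemes to one-sided-error heuristics -/

/-- `|1ⁿ| = n` (Mathlib's `unaryDecodeNat` is `List.length`; private copy, cf. `DistProblemsProofs.lean`).
[Mathlib `Computability.unary_decode_encode_nat`] [folklore] -/
private theorem length_unaryEncodeNat_eq (n : ℕ) : (unaryEncodeNat n).length = n :=
  unary_decode_encode_nat n

/-- If the support of `Dₙ` is covered by `E ∪ F` then `1 ≤ Pr_{x ∼ Dₙ}[E] + Pr_{x ∼ Dₙ}[F]`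
(subadditivity of the outer measure of a `PMF`, whose total mass sits on the support). A deliberate
dot-notation extension of `Ensemble`. [Mathlib `PMF.toOuterMeasure_apply_eq_one_iff`,
`MeasureTheory.measure_union_le`] [folklore] -/
theorem Ensemble.one_le_prob_add_prob_of_support_subset (D : Ensemble) (n : ℕ)
    {E F : Set (List Bool)} (h : (D n).support ⊆ E ∪ F) : 1 ≤ D.prob n E + D.prob n F := by
  have h1 : (D n).toOuterMeasure (E ∪ F) = 1 := (PMF.toOuterMeasure_apply_eq_one_iff _ _).2 h
  have h2 : (D n).toOuterMeasure (E ∪ F) ≤ (D n).toOuterMeasure E + (D n).toOuterMeasure F :=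
    _root_.MeasureTheory.measure_union_le E F
  have hle1 : ∀ G : Set (List Bool), (D n).toOuterMeasure G ≤ 1 := fun G => by
    have h := (D n).toOuterMeasure_mono (s := G) (t := Set.univ) (by simp)
    rwa [(PMF.toOuterMeasure_apply_eq_one_iff _ _).2 (Set.subset_univ _)] at h
  have hE : (D n).toOuterMeasure E ≠ ⊤ := ne_top_of_le_ne_top ENNReal.one_ne_top (hle1 E)
  have hF : (D n).toOuterMeasure F ≠ ⊤ := ne_top_of_le_ne_top ENNReal.one_ne_top (hle1 F)
  unfold Ensemble.prob
  rw [← ENNReal.toReal_add hE hF, ← ENNReal.toReal_one]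
  exact ENNReal.toReal_mono (ENNReal.add_ne_top.2 ⟨hE, hF⟩) (h1 ▸ h2)

/-- **`AvgP ⊆ Avg¹_{1-n^{-c}} P` (p. 9), for ensembles with finite `supp D₁`, every `c ≥ 1`.** From an
errorless heuristic scheme `S(x; 1ⁿ, 1ᵐ)` for `(L, D)` define `A(x; 1ⁿ) := S(x; 1ⁿ, 1²)` with `⊥ ↦ 0`
for `n ≠ 1`, and `A(x; 1¹) := L(x)` hard-wired for the finitely many `x ∈ supp D₁` (elsewhere at
`n = 1` anything, here also the hard-wired branch on short codes). Then: `A` is polynomial-time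
(`polyTimeComputable_decScheme` and `polyTimeComputable_getD_optBoolEnc` around `S`, the preprocessing
`⟨x, 1ⁿ⟩ ↦ ⟨x, ⟨1ⁿ, 1²⟩⟩` by `fanoutFn`, and finite patching `mem_FP_of_eqOn_le` on the codes of
length `< 2B + 4`, `B` bounding `|x|` on `supp D₁`); it has no false positives on `supp Dₙ`
(errorlessness of `S`); and `Pr_{x ∼ Dₙ}[A = L] ≥ 1 - Pr[S(·; 1ⁿ, 1²) = ⊥] ≥ 1/2 ≥ n^{-c}` for
`n ≥ 2`, `= 1` for `n = 1`, while at `n = 0` the bound `1 - 1/0 = 1` (Lean) is void. The paper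
states the inclusion without the proviso ("it is easy to see that `AvgP ⊆ Avg¹_{1-n^{-c}} P`"); the
proviso covers its use (`D ∈ {U, T}`, indeed all of `PSamp`).
[Hirahara 2021 (ECCC TR21-058), p. 9; Bogdanov–Trevisan 2006, §2.2 (closing remark)]
[cite: Hirahara2021, §1.3 (p. 9)] -/
theorem mem_Avg1DeltaP_of_mem_AvgP {Q : DistProblem} (hQ : Q ∈ AvgP)
    (hfin : (Q.dist 1).support.Finite) {c : ℕ} (hc : c ≠ 0) :
    Q ∈ Avg1DeltaP fun n => 1 - 1 / (n : ℝ) ^ c := by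
  obtain ⟨S, hS, herr, hfail⟩ := hQ
  -- (a) the total realiser of `(x, t, m) ↦ S(x; 1ᵗ, 1ᵐ)` with `⊥ ↦ 0`, on all words
  have hG : (fun w : List Bool => encodeBool
      ((S (decScheme w).1 (decScheme w).2.1 (decScheme w).2.2).getD false)) ∈ FP := by
    obtain ⟨p, M, hM⟩ := PolyTimeComputable.comp_holds
      (PolyTimeComputable.comp_holds polyTimeComputable_getD_optBoolEnc hS)
      polyTimeComputable_decScheme
    exact ⟨p, M, fun w => hM w⟩
  -- (b) the preprocessing `z ↦ ⟨fstF z, ⟨sndF z, 1²⟩⟩`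
  have hpre : fanoutFn Brick.fstF (fanoutFn Brick.sndF fun _ => unaryEncodeNat 2) ∈ FP :=
    fanoutFn_mem_FP Brick.fstF_mem_FP (fanoutFn_mem_FP Brick.sndF_mem_FP (const_mem_FP _))
  set F : List Bool → List Bool := (fun w : List Bool => encodeBool
      ((S (decScheme w).1 (decScheme w).2.1 (decScheme w).2.2).getD false)) ∘
      fanoutFn Brick.fstF (fanoutFn Brick.sndF fun _ => unaryEncodeNat 2) with hFdef
  have hF : F ∈ FP := comp_mem_FP hG hpre
  have hF_apply : ∀ (x : List Bool) (n : ℕ),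
      F (paramEnc (x, n)) = encodeBool ((S x n 2).getD false) := by
    intro x n
    have hdec : decScheme (boolPair x (boolPair (unaryEncodeNat n) (unaryEncodeNat 2))) = (x, n, 2) :=
      decScheme_schemeEnc (x, n, 2)
    simp only [hFdef, Function.comp_apply, paramEnc, fanoutFn_apply, Brick.fstF_boolPair,
      Brick.sndF_boolPair, hdec]
  -- (c) a length bound on the support of `D₁`
  obtain ⟨B, hB⟩ : ∃ B : ℕ, ∀ x ∈ (Q.dist 1).support, x.length ≤ B := by
    obtain ⟨B, hB⟩ := (hfin.image List.length).bddAbove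
    exact ⟨B, fun x hx => hB (Set.mem_image_of_mem _ hx)⟩
  -- (d) the algorithm and its patched realiser
  set n₀ : ℕ := 2 * B + 4 with hn₀
  set A : List Bool → ℕ → Bool := fun x n =>
    if (paramEnc (x, n)).length < n₀ ∧ n = 1 then Q.lang.boolIndicator x else (S x n 2).getD false
    with hAdef
  set F' : List Bool → List Bool := fun z =>
    if z.length < n₀ then encodeBool (A (boolUnpair z).1 (boolUnpair z).2.length) else F z
    with hF'def
  have hF' : F' ∈ FP := mem_FP_of_eqOn_le hF n₀ fun z hz => by
    simp only [hF'def, if_neg (not_lt.2 hz)]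
  have hF'_apply : ∀ (x : List Bool) (n : ℕ), F' (paramEnc (x, n)) = encodeBool (A x n) := by
    intro x n
    by_cases hlt : (paramEnc (x, n)).length < n₀
    · simp only [hF'def, if_pos hlt]
      simp [paramEnc, length_unaryEncodeNat_eq]
    · have hA : A x n = (S x n 2).getD false := by
        simp only [hAdef]
        rw [if_neg fun h => hlt h.1]
      simp only [hF'def, if_neg hlt, hF_apply, hA]
  refine ⟨A, ?_, ?_, ?_⟩
  · -- polynomial time
    obtain ⟨p, M, hM⟩ := hF'
    refine ⟨p, M, fun q => ?_⟩
    obtain ⟨x, n⟩ := q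
    have h := hM (paramEnc (x, n))
    rw [hF'_apply] at h
    exact h
  · -- no false positives on the support
    intro n x hx hxL
    simp only [hAdef]
    split_ifs with h
    · exact (Set.notMem_iff_boolIndicator _ _).1 hxL
    · rcases hSx : S x n 2 with _ | b
      · rfl
      · rw [Option.getD_some, herr 2 n x hx b hSx]
        exact (Set.notMem_iff_boolIndicator _ _).1 hxL
  · -- success probability
    intro n
    change 1 - (1 - 1 / (n : ℝ) ^ c) ≤ Q.dist.prob n {x | A x n = Q.lang.boolIndicator x}
    rcases Nat.lt_trichotomy n 1 with hn | rfl | hn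
    · obtain rfl : n = 0 := by omega
      have h0 : (1 : ℝ) - (1 - 1 / ((0 : ℕ) : ℝ) ^ c) = 0 := by simp [hc]
      rw [h0]
      exact Ensemble.prob_nonneg _ _ _
    · have hsub : (Q.dist 1).support ⊆ {x | A x 1 = Q.lang.boolIndicator x} := by
        intro x hx
        have hlt : (paramEnc (x, 1)).length < n₀ := by
          have hx' := hB x hx
          simp only [paramEnc, length_boolPair, length_unaryEncodeNat_eq, hn₀]
          omega
        change A x 1 = _
        simp only [hAdef, if_pos (And.intro hlt rfl)]
      have h1 : Q.dist.prob 1 {x | A x 1 = Q.lang.boolIndicator x} = 1 := by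
        rw [Ensemble.prob, (PMF.toOuterMeasure_apply_eq_one_iff _ _).2 hsub, ENNReal.toReal_one]
      rw [h1]
      norm_num
    · have hcov : (Q.dist n).support ⊆
          {x | S x n 2 = none} ∪ {x | A x n = Q.lang.boolIndicator x} := by
        intro x hx
        rcases hSx : S x n 2 with _ | b
        · exact Or.inl hSx
        · refine Or.inr ?_
          change A x n = _
          have hA : A x n = (S x n 2).getD false := by
            simp only [hAdef]
            rw [if_neg]
            rintro ⟨-, h1⟩
            omega
          rw [hA, hSx, Option.getD_some]
          exact herr 2 n x hx b hSx
      have hle := Q.dist.one_le_prob_add_prob_of_support_subset n hcov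
      have hf : Q.dist.prob n {x | S x n 2 = none} ≤ 1 / 2 := by
        have := hfail n 2 two_pos
        norm_num at this ⊢
        exact this
      have hnc : (1 : ℝ) / (n : ℝ) ^ c ≤ 1 / 2 := by
        have h2 : (2 : ℝ) ≤ (n : ℝ) ^ c := by
          have h2n : (2 : ℝ) ≤ n := by exact_mod_cast hn
          calc (2 : ℝ) = 2 ^ 1 := by norm_num
            _ ≤ (n : ℝ) ^ 1 := by rw [pow_one, pow_one]; exact h2n
            _ ≤ (n : ℝ) ^ c := pow_le_pow_right₀ (by linarith) (Nat.one_le_iff_ne_zero.2 hc)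
        exact one_div_le_one_div_of_le two_pos h2
      linarith

/-! ### `DistNP ⊆ AvgP ⟹ coNP × {U, T} ⊆ Avg¹_{1-n^{-c}} P` -/

/-- `supp U₁` is finite (the strings of length `1`). [Mathlib `List.finite_length_eq`] [folklore] -/
private theorem finite_support_uniformEnsemble (n : ℕ) : (uniformEnsemble n).support.Finite := by
  have h : (uniformEnsemble n).support = {x : List Bool | x.length = n} :=
    Set.ext (mem_support_uniformEnsemble_iff n)
  rw [h]
  exact List.finite_length_eq Bool n

/-- **`DistNP ⊆ AvgP ⟹ coNP × {U, T} ⊆ Avg¹_{1-n^{-c}} P` for every `c ≥ 1`.** For `L ∈ coNP` and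
`D ∈ {U, T}`: `D ∈ PSamp` (`uniformEnsemble_mem_PSamp_holds`, `tallyEnsemble_mem_PSamp`), so
`(Lᶜ, D) ∈ DistNP ⊆ AvgP`; complementing (`AvgP_compl`) gives `(L, D) ∈ AvgP`, and
`mem_Avg1DeltaP_of_mem_AvgP` applies since `supp U₁` and `supp T₁` are finite. This is the bridge
between the hypothesis of Thm. 1.6 (1) / Lemma 2.2 (1) (`DistNP ⊆ AvgP`) and that of the paper's
"actual results" Thm. 1.8 / Cor. 8.12 / Thm. 11.1 (`coNP × {U, T} ⊆ Avg¹_{1-n^{-c}} P`), printed on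
p. 9 as "`Avg_P P ⊆ AvgP ⊆ Avg¹_{1-n^{-c}} P`". [Hirahara 2021 (ECCC TR21-058), p. 9 and §11 (p. 51)]
[cite: Hirahara2021, §1.3 (p. 9)] -/
theorem distClass_coNP_subset_Avg1DeltaP_of_DistNP_subset_AvgP (h : DistNP ⊆ AvgP) {c : ℕ}
    (hc : c ≠ 0) :
    distClass coNP {uniformEnsemble, tallyEnsemble} ⊆ Avg1DeltaP fun n => 1 - 1 / (n : ℝ) ^ c := by
  rintro ⟨L, D⟩ ⟨hL, hD⟩
  change L ∈ coNP at hL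
  change D ∈ ({uniformEnsemble, tallyEnsemble} : Set Ensemble) at hD
  have hD' : D ∈ PSamp := by
    rcases hD with rfl | rfl
    exacts [uniformEnsemble_mem_PSamp_holds, tallyEnsemble_mem_PSamp]
  have h₁ : (⟨Lᶜ, D⟩ : DistProblem) ∈ AvgP := h ⟨hL, hD'⟩
  have h₂ : (⟨L, D⟩ : DistProblem) ∈ AvgP := by
    have h' := AvgP_compl h₁
    rwa [compl_compl] at h'
  have hfin : (D 1).support.Finite := by
    rcases hD with rfl | rfl
    · exact finite_support_uniformEnsemble 1
    · rw [support_tallyEnsemble]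
      exact Set.finite_singleton _
  exact mem_Avg1DeltaP_of_mem_AvgP h₂ hfin hc

/-! ### Lemma 2.2 (1) from Cor. 8.12 / Thm. 8.9 (for `UP`) -/

/-- **Hirahara's Lemma 2.2 (1) from Cor. 8.12 (for `UP`).** Assuming the `UP` case of Cor. 8.12 —
Cor. 8.12 specialised along Fact 8.4: `coNP × {U, T} ⊆ Avg¹_{1-n^{-c}} P` for some `c` ⟹ every
`L ∈ UP` has a universal heuristic scheme, w.r.t. every efficient universal machine `U` (the explicit
hypothesis `h`; a proved consequence of the named fact `Hirahara2021_UP_searchUHS_of_Avg1P`, Thm. 8.9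
for `UP`-type verifiers, by `Hirahara2021_UP_hasUHS_of_Avg1P_of_search`) —, the named fact
`Hirahara2021_hasUHS_of_mem_UP` (Lemma 2.2 (1): `DistNP ⊆ AvgP ⟹` every `L ∈ UP` has a universal
heuristic scheme) holds, by `distClass_coNP_subset_Avg1DeltaP_of_DistNP_subset_AvgP` with `c = 1`. This
is the printed derivation "Since `UP ⊆ NP_sv`, Item 1 of Theorem 1.6 is a special case of
Theorem 11.1" (p. 51), whose remaining depth is Cor. 8.12.
[Hirahara 2021 (ECCC TR21-058), Lemma 2.2 (1), Cor. 8.12, Fact 8.4, Thm. 11.1 and p. 51]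
[cite: Hirahara2021, Lemma 2.2 (1)] -/
theorem Hirahara2021_hasUHS_of_mem_UP_of
    (h : ∀ U : UniversalMachine,
      (∃ c : ℕ, distClass coNP {uniformEnsemble, tallyEnsemble} ⊆
        Avg1DeltaP fun n => 1 - 1 / (n : ℝ) ^ c) →
      ∀ L ∈ UP, U.HasUniversalHeuristicScheme L) :
    Hirahara2021_hasUHS_of_mem_UP := fun U hD L hL =>
  h U ⟨1, distClass_coNP_subset_Avg1DeltaP_of_DistNP_subset_AvgP hD one_ne_zero⟩ L hL

/-- **Hirahara's Lemma 2.2 (1) from Thm. 8.9 (for `UP`-type verifiers).** Assuming the named fact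
`Hirahara2021_UP_searchUHS_of_Avg1P` (Thm. 8.9 restricted along Fact 8.4 to `UP`-type verifiers:
`coNP × {U, T} ⊆ Avg¹_{1-n^{-c}} P` for some `c` ⟹ the search problem of every `UP`-type verifier
admits a universal heuristic scheme, Def. 8.8), the named fact `Hirahara2021_hasUHS_of_mem_UP`
(Lemma 2.2 (1)) holds: `DistNP ⊆ AvgP ⟹ coNP × {U, T} ⊆ Avg¹_{1-1/n} P`
(`distClass_coNP_subset_Avg1DeltaP_of_DistNP_subset_AvgP`), then Cor. 8.12 for `UP`
(`Hirahara2021_UP_hasUHS_of_Avg1P_of_search`: a decision problem reduces to its search version). This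
is the whole printed route of §11 for Item 1 of Thm. 1.6 (p. 51: "By Corollary 8.12, every language
in `NP_sv` admits a universal heuristic scheme … Since `UP ⊆ NP_sv`, Item 1 of Theorem 1.6 is a
special case of Theorem 11.1") down to Thm. 8.9, whose formalised proof relative to its §3–§5
ingredients is `Hirahara2021_UP_searchUHS_of_Avg1P_of` (`UPSearchAssembly.lean`).
[Hirahara 2021 (ECCC TR21-058), Lemma 2.2 (1), Thm. 8.9, Cor. 8.12, Fact 8.4, Thm. 11.1 and p. 51]
[cite: Hirahara2021, Lemma 2.2 (1)] -/
theorem Hirahara2021_hasUHS_of_mem_UP_of_search (h : Hirahara2021_UP_searchUHS_of_Avg1P) :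
    Hirahara2021_hasUHS_of_mem_UP :=
  Hirahara2021_hasUHS_of_mem_UP_of (Hirahara2021_UP_hasUHS_of_Avg1P_of_search h)

end Literature.Computability.MetaComplexity
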